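import Literature.AlgebraicGeometry.Motives.FiniteQuotientFlat
import Literature.AlgebraicGeometry.Morphisms.EqOfFieldPoints
import HarnessLib

/-!
# Descent of invariant morphisms along `p × T` and `p × p` for a finite-group quotient `p : X → X/Δ`
# (SGA 1, Exp. V, Prop. 1.9 «le quotient commute au changement de base plat», for a reduced base)

Topic `Literature/AlgebraicGeometry/Motives`; namespace `Literature.AlgebraicGeometry.Motives`.  THEOREMS ONLY.
Cell hodgecm-mathlib, fan B, row VI-5 (`AlbaneseTraceOfFiniteQuotient`), package P2 «∇ of a quotient», file F2 of the
plan announced 2026-08-28T03:45Z.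

Let `k` be a field, `X` a projective `k`-scheme with an action `act : Δ →* Aut X` of a finite group, and `p : X ⟶ Y` a
quotient for separated test objects (`IsSepQuotient`, `Y` separated) whose underlying morphism is FLAT (e.g. `X`, `Y`
smooth: `Motives.flat_left_of_isSepQuotient`).

* `exists_desc_whiskerRight_of_isSepQuotient` — **descent along `p ▷ T = p ×_k T`** for a REDUCED, locally Noetherian
  `k`-scheme `T`: every morphism `φ : X ⊗ T ⟶ W` to a separated `k`-scheme which is invariant under `act g ▷ T` factors
  (uniquely) through `p ▷ T`.  PROOF: `(p ▷ T).left` is flat, surjective and quasi-compact, hence an effective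
  epimorphism of schemes (Mathlib, fpqc descent); so `φ` descends iff it equalises the kernel pair
  `(X ⊗ T) ×_{Y ⊗ T} (X ⊗ T) ⇉ X ⊗ T`.  The kernel pair is flat over `T`, and `T` is reduced, so by
  `Morphisms.hom_ext_of_flat_of_forall_field` it suffices to check the equality on the fibre over every field point
  `Spec K → T`; there it follows from the fact that `p ⊗_k K : X_K → Y_K` is again a (geometric, hence categorical)
  quotient — quotients by finite groups commute with extension of the base field
  (`RelativeSpec.ActionOver.isGeometricQuotient_baseChange`, [SGA1] V 1.9).
* `exists_desc_tensorHom_of_isSepQuotient` — **descent along `p ⊗ p = (p ▷ X) ≫ (Y ◁ p)`**: for `Y` reduced, every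
  `(Δ × Δ)`-invariant `φ : X ⊗ X ⟶ W` factors through `p ⊗ p` (two applications of the first theorem and the symmetry
  of `⊗`).

No kernel pair of `∇p`, no reducedness of `X ×_Y X` is needed.  HC_CM is proved only modulo the 7 printed citations
until rung 0 closes; nothing here changes that.

## References
* [SGA1] A. Grothendieck, *SGA 1*, Exp. V, §1, Prop. 1.1, Prop. 1.9.
* [MumfordAV1970] D. Mumford, *Abelian Varieties* (1970), §7, Thm. p. 66 and Remark (categorical quotient).
* The Stacks Project, Tag 023Q (fpqc covers are universal effective epimorphisms).
-/

noncomputable section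

open CategoryTheory CategoryTheory.Limits AlgebraicGeometry MonoidalCategory CartesianMonoidalCategory
open Literature.AlgebraicGeometry.RelativeSpec

universe u v

namespace Literature.AlgebraicGeometry.Motives

variable {k : Type u} [Field k] {Δ : Type v} [Group Δ] [Finite Δ] {X Y : SchemeOver k}

/-- A `k`-scheme with separated structure map is a separated scheme. [folklore] -/
private theorem isSeparated_left_of_isSeparated_hom' (W : SchemeOver k) (hW : IsSeparated W.hom) :
    W.left.IsSeparated :=
  ⟨by rw [← terminal.comp_from W.hom]; infer_instance⟩

/-- A property stable under base change and composition, containing identities, passes from `ψ.left` to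
`(ψ ▷ T).left = ψ ×_k T`. [folklore] -/
private theorem whiskerRight_left_mem' (P : MorphismProperty Scheme.{u}) [P.IsStableUnderBaseChange]
    [P.IsStableUnderComposition] [P.ContainsIdentities] {X' Y' T : SchemeOver k} (ψ : X' ⟶ Y')
    (hψ : P ψ.left) : P (ψ ▷ T).left := by
  rw [Over.whiskerRight_left]
  exact MorphismProperty.pullbackMap hψ (P.id_mem _) (Over.w ψ).symm (Category.id_comp _).symm

/-- The structure morphism `X → Spec k` of a scheme over a field is flat. [folklore] -/
private theorem flat_hom (Z : SchemeOver k) : Flat Z.hom := by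
  rw [IsZariskiLocalAtSource.iff_of_openCover (P := @Flat) Z.left.affineCover]
  intro i
  obtain ⟨φ, hφ⟩ := Spec.map_surjective (Z.left.affineCover.f i ≫ Z.hom)
  have hflat : Flat (Spec.map φ) := by
    rw [HasRingHomProperty.Spec_iff (P := @Flat)]
    letI := φ.hom.toAlgebra
    exact RingHom.flat_algebraMap_iff.mpr (inferInstance : Module.Flat k _)
  rwa [hφ] at hflat

/-- **The quotient map is a geometric quotient (Mumford's (1), (2)) for the action over `Spec k`**, transported
from the glued `X → X/Δ` along `Y ≅ X/Δ`. [cite: MumfordAV1970, §7 Thm. p. 66] -/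
theorem isGeometricQuotient_left_of_isSepQuotient (hX : IsProjectiveOver X) (hY : IsSeparated Y.hom)
    (act : Δ →* Aut X) (p : X ⟶ Y) (hq : IsSepQuotient (fun g => act g) p) :
    (⟨((Over.forget _).mapAut X).comp act, fun g => Over.w (act g).hom⟩ : ActionOver X.hom Δ).IsGeometricQuotient
      p.left ∧ IsAffineHom p.left := by
  haveI : IsProper X.hom := hX.isProper
  haveI : IsSeparated X.hom := inferInstance
  let ρ : ActionOver X.hom Δ := ⟨((Over.forget _).mapAut X).comp act, fun g => Over.w (act g).hom⟩
  have hcov := ActionOver.forall_exists_stableAffineOpen_of_isProjectiveOver ρ hX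
  obtain ⟨i, hi⟩ : ∃ i : Y ≅ finiteQuotient ρ, p ≫ i.hom = finiteQuotient.mk ρ hcov :=
    isoFiniteQuotient_of_isSepQuotient' hX act p hY hq
  let e : (finiteQuotient ρ).left ≅ Y.left :=
    ⟨i.inv.left, i.hom.left, by rw [← Over.comp_left, i.inv_hom_id]; rfl,
      by rw [← Over.comp_left, i.hom_inv_id]; rfl⟩
  have hp : p.left = (finiteQuotient.mk ρ hcov).left ≫ e.hom := by
    change p.left = (finiteQuotient.mk ρ hcov).left ≫ i.inv.left
    rw [← Over.comp_left, ← hi, Category.assoc, Iso.hom_inv_id, Category.comp_id]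
  refine ⟨?_, ?_⟩
  · rw [hp]
    exact (ρ.isGeometricQuotient_gluedMk hcov).of_isoTarget e
  · rw [hp]
    haveI := finiteQuotient.isAffineHom_mk_left ρ hcov
    infer_instance

/-- **Descent along `p ×_k T` for a reduced `T`** ([SGA1] V Prop. 1.9 for the flat base change `T → Spec k`, in the
form needed here).  Let `p : X ⟶ Y` be a quotient of the projective `k`-scheme `X` by the finite group `Δ` for
separated test objects, with `Y` separated and `p` flat, and let `T` be a reduced, locally Noetherian `k`-scheme.  Then
every morphism `φ : X ⊗ T ⟶ W` to a separated `k`-scheme `W` with `(act g ▷ T) ≫ φ = φ` for all `g` factors through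
`p ▷ T`.  (Effective epimorphism `p ▷ T`; the kernel-pair identity is checked on field-valued fibres over `T`, where
`p_K` is a quotient, and the fibres are schematically dense.) [cite: SGA1, Exp. V Prop. 1.9]
[cite: MumfordAV1970, §7 Thm. p. 66 (Remark)] -/
theorem exists_desc_whiskerRight_of_isSepQuotient (hX : IsProjectiveOver X) (hY : IsSeparated Y.hom)
    (act : Δ →* Aut X) (p : X ⟶ Y) (hq : IsSepQuotient (fun g => act g) p) [Flat p.left]
    (T : SchemeOver k) [IsReduced T.left] [IsLocallyNoetherian T.left]
    {W : SchemeOver k} (hW : IsSeparated W.hom) (φ : X ⊗ T ⟶ W)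
    (hφ : ∀ g : Δ, ((act g).hom ▷ T) ≫ φ = φ) :
    ∃ ψ : Y ⊗ T ⟶ W, (p ▷ T) ≫ ψ = φ := by
  haveI : W.left.IsSeparated := isSeparated_left_of_isSeparated_hom' W hW
  let ρ : ActionOver X.hom Δ := ⟨((Over.forget _).mapAut X).comp act, fun g => Over.w (act g).hom⟩
  obtain ⟨hgq, hpaff⟩ := isGeometricQuotient_left_of_isSepQuotient hX hY act p hq
  haveI := hpaff
  haveI : Surjective p.left := surjective_left_of_isSepQuotient hX hY act p hq
  -- `(p ▷ T).left` is flat, surjective, quasi-compact: an effective epimorphism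
  let pT := (p ▷ T).left
  haveI : Flat pT := whiskerRight_left_mem' @Flat p ‹_›
  haveI : Surjective pT := whiskerRight_left_mem' @Surjective p ‹_›
  haveI : QuasiCompact pT := whiskerRight_left_mem' @QuasiCompact p inferInstance
  haveI : EffectiveEpi pT := inferInstance
  -- the kernel-pair identity
  have key : ∀ {Z : Scheme.{u}} (g₁ g₂ : Z ⟶ (X ⊗ T).left), g₁ ≫ pT = g₂ ≫ pT →
      g₁ ≫ φ.left = g₂ ≫ φ.left := by
    -- reduce to the kernel pair `K' = (X ⊗ T) ×_{Y ⊗ T} (X ⊗ T)`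
    suffices hK : pullback.fst pT pT ≫ φ.left = pullback.snd pT pT ≫ φ.left by
      intro Z g₁ g₂ hg
      rw [← pullback.lift_fst g₁ g₂ hg, Category.assoc, hK, ← Category.assoc, pullback.lift_snd]
    -- `K'` is flat over `T`; check on field-valued fibres
    haveI : Flat X.hom := flat_hom X
    haveI : Flat (pullback.fst pT pT) := MorphismProperty.pullback_fst _ _ ‹Flat pT›
    haveI : Flat (pullback.snd X.hom T.hom) := MorphismProperty.pullback_snd _ _ ‹Flat X.hom›
    haveI : Flat (pullback.fst pT pT ≫ pullback.snd X.hom T.hom) := MorphismProperty.comp_mem _ _ _ ‹_› ‹_›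
    refine Literature.AlgebraicGeometry.Morphisms.hom_ext_of_flat_of_forall_field
      (pullback.fst pT pT ≫ pullback.snd X.hom T.hom) fun K _ t => ?_
    -- notation on the fibre over `t : Spec K → T`
    set q := pullback.fst pT pT ≫ pullback.snd X.hom T.hom with hqdef
    let ft := pullback.fst q t
    let st := pullback.snd q t
    let a₁ := ft ≫ pullback.fst pT pT
    let a₂ := ft ≫ pullback.snd pT pT
    have hsndXT : pT ≫ pullback.snd Y.hom T.hom = pullback.snd X.hom T.hom := Over.whiskerRight_left_snd p
    have hfstXT : pT ≫ pullback.fst Y.hom T.hom = pullback.fst X.hom T.hom ≫ p.left :=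
      Over.whiskerRight_left_fst p
    have ha : a₁ ≫ pT = a₂ ≫ pT := by
      simp only [a₁, a₂, Category.assoc, pullback.condition]
    have ha₁ : a₁ ≫ pullback.snd X.hom T.hom = st ≫ t := by
      simp only [a₁, Category.assoc]
      exact pullback.condition
    have ha₂ : a₂ ≫ pullback.snd X.hom T.hom = st ≫ t := by
      rw [← ha₁]
      simp only [a₁, a₂, Category.assoc, ← hsndXT]
      rw [← Category.assoc (pullback.snd pT pT), ← pullback.condition, Category.assoc]
    change a₁ ≫ φ.left = a₂ ≫ φ.left
    -- the field point as a `k`-scheme `κ = Spec K → Spec k`, and `tt : κ ⟶ T`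
    obtain ⟨ψ₀, hψ₀⟩ := Spec.map_surjective (t ≫ T.hom)
    let ψ : k →+* K := ψ₀.hom
    have hψ : Spec.map (CommRingCat.ofHom ψ) = t ≫ T.hom := by rw [CommRingCat.ofHom_hom, hψ₀]
    let κ : SchemeOver k := Over.mk (Spec.map (CommRingCat.ofHom ψ))
    let tt : κ ⟶ T := Over.homMk t hψ.symm
    -- the test scheme `P = K' ×_T Spec K` over `k`, and its two points as `k`-morphisms `A_i : P ⟶ X ⊗ T`
    let P : SchemeOver k := Over.mk (st ≫ κ.hom)
    have hA : ∀ a : pullback q t ⟶ (X ⊗ T).left, a ≫ pullback.snd X.hom T.hom = st ≫ t →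
        a ≫ (X ⊗ T).hom = P.hom := fun a hat => by
      change a ≫ (X ⊗ T).hom = st ≫ Spec.map (CommRingCat.ofHom ψ)
      rw [← Over.w (CartesianMonoidalCategory.snd X T), Over.snd_left, ← Category.assoc, hat, hψ,
        Category.assoc]
    let A₁ : P ⟶ X ⊗ T := Over.homMk a₁ (hA a₁ ha₁)
    let A₂ : P ⟶ X ⊗ T := Over.homMk a₂ (hA a₂ ha₂)
    let St : P ⟶ κ := Over.homMk st rfl
    have hAsnd : ∀ {A : P ⟶ X ⊗ T}, A.left ≫ pullback.snd X.hom T.hom = st ≫ t →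
        A ≫ CartesianMonoidalCategory.snd X T = St ≫ tt := fun h =>
      Over.OverMorphism.ext (by rw [Over.comp_left, Over.comp_left, Over.snd_left]; exact h)
    have hA₁ : A₁ ≫ CartesianMonoidalCategory.snd X T = St ≫ tt := hAsnd ha₁
    have hA₂ : A₂ ≫ CartesianMonoidalCategory.snd X T = St ≫ tt := hAsnd ha₂
    have hAA : A₁ ≫ (p ▷ T) = A₂ ≫ (p ▷ T) := Over.OverMorphism.ext ha
    -- they factor through `X ⊗ κ`: `B_i = (pr_X ∘ A_i, St)`
    let B₁ : P ⟶ X ⊗ κ := CartesianMonoidalCategory.lift (A₁ ≫ CartesianMonoidalCategory.fst X T) St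
    let B₂ : P ⟶ X ⊗ κ := CartesianMonoidalCategory.lift (A₂ ≫ CartesianMonoidalCategory.fst X T) St
    have hB : ∀ {A : P ⟶ X ⊗ T}, A ≫ CartesianMonoidalCategory.snd X T = St ≫ tt →
        CartesianMonoidalCategory.lift (A ≫ CartesianMonoidalCategory.fst X T) St ≫ (X ◁ tt) = A := by
      intro A hAs
      apply CartesianMonoidalCategory.hom_ext
      · rw [Category.assoc, CartesianMonoidalCategory.whiskerLeft_fst, CartesianMonoidalCategory.lift_fst]
      · rw [Category.assoc, CartesianMonoidalCategory.whiskerLeft_snd, ← Category.assoc,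
          CartesianMonoidalCategory.lift_snd, hAs]
    have hB₁ : B₁ ≫ (X ◁ tt) = A₁ := hB hA₁
    have hB₂ : B₂ ≫ (X ◁ tt) = A₂ := hB hA₂
    have hBB : B₁ ≫ (p ▷ κ) = B₂ ≫ (p ▷ κ) := by
      apply CartesianMonoidalCategory.hom_ext
      · rw [Category.assoc, Category.assoc, CartesianMonoidalCategory.whiskerRight_fst,
          CartesianMonoidalCategory.lift_fst_assoc, CartesianMonoidalCategory.lift_fst_assoc, Category.assoc,
          Category.assoc, ← CartesianMonoidalCategory.whiskerRight_fst, ← Category.assoc, ← Category.assoc, hAA]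
      · rw [Category.assoc, Category.assoc, CartesianMonoidalCategory.whiskerRight_snd,
          CartesianMonoidalCategory.lift_snd, CartesianMonoidalCategory.lift_snd]
    -- `φ` restricted to `X ⊗ κ` is invariant, and `p ▷ κ = p_K` is a geometric quotient (SGA 1, V 1.9)
    let φκ : X ⊗ κ ⟶ W := (X ◁ tt) ≫ φ
    have hφκ : ∀ g : Δ, ((act g).hom ▷ κ) ≫ φκ = φκ := fun g => by
      simp only [φκ, ← Category.assoc, ← whisker_exchange]
      rw [Category.assoc, hφ g]
    let ρ' : ActionOver (pullback.snd X.hom κ.hom) Δ :=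
      ⟨((Over.forget _).mapAut (X ⊗ κ)).comp (((tensorRight κ).mapAut X).comp act), fun g =>
        Over.whiskerRight_left_snd (act g).hom⟩
    have hgq' : ρ'.IsGeometricQuotient (p ▷ κ).left :=
      ρ.isGeometricQuotient_baseChange ψ (Over.w p) hgq ρ'
        (fun g => Over.whiskerRight_left_fst (act g).hom) (p ▷ κ).left
        (Over.whiskerRight_left_fst p) (Over.whiskerRight_left_snd p)
    obtain ⟨ψκ, hψκ⟩ := hgq'.exists_desc φκ.left fun g => congrArg CommaMorphism.left (hφκ g)
    -- conclude on the fibre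
    have e₁ : a₁ ≫ φ.left = (B₁ ≫ φκ).left := by
      change (A₁ ≫ φ).left = (B₁ ≫ φκ).left
      rw [← hB₁, Category.assoc]
    have e₂ : a₂ ≫ φ.left = (B₂ ≫ φκ).left := by
      change (A₂ ≫ φ).left = (B₂ ≫ φκ).left
      rw [← hB₂, Category.assoc]
    have h₁ : (B₁ ≫ φκ).left = (B₁ ≫ (p ▷ κ)).left ≫ ψκ := by
      rw [Over.comp_left, Over.comp_left]
      exact (congrArg (B₁.left ≫ ·) hψκ.symm).trans (Category.assoc _ _ _).symm
    have h₂ : (B₂ ≫ φκ).left = (B₂ ≫ (p ▷ κ)).left ≫ ψκ := by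
      rw [Over.comp_left, Over.comp_left]
      exact (congrArg (B₂.left ≫ ·) hψκ.symm).trans (Category.assoc _ _ _).symm
    have step : (B₁ ≫ φκ).left = (B₂ ≫ φκ).left := by rw [h₁, h₂, hBB]
    exact e₁.trans (step.trans e₂.symm)
  -- effective epimorphism: descend
  refine ⟨Over.homMk (EffectiveEpi.desc pT φ.left key) ?_, Over.OverMorphism.ext (EffectiveEpi.fac pT φ.left key)⟩
  rw [← cancel_epi pT, ← Category.assoc, EffectiveEpi.fac pT φ.left key, Over.w φ]
  exact (Over.w (p ▷ T)).symm

/-- **Descent along `p ⊗ p = p ×_k p`.**  With `p : X ⟶ Y` as above (`X` projective, `Y` separated and reduced, `p` a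
flat quotient by `Δ` for separated test objects), every morphism `φ : X ⊗ X ⟶ W` to a separated `k`-scheme which is
invariant under `act s ⊗ act t` for all `s, t ∈ Δ` factors through `p ⊗ p`: descend along `p ▷ X`, observe that the
descended morphism is invariant under `Y ◁ act t` (cancel the epimorphism `p ▷ X`), and descend along `Y ◁ p` using the
symmetry of `⊗`. [cite: SGA1, Exp. V Prop. 1.9] [cite: MumfordAV1970, §7 Thm. p. 66 (Remark)] -/
theorem exists_desc_tensorHom_of_isSepQuotient (hX : IsProjectiveOver X) (hY : IsSeparated Y.hom)
    (act : Δ →* Aut X) (p : X ⟶ Y) (hq : IsSepQuotient (fun g => act g) p) [Flat p.left]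
    [IsReduced X.left] [IsReduced Y.left] [LocallyOfFiniteType Y.hom]
    {W : SchemeOver k} (hW : IsSeparated W.hom) (φ : X ⊗ X ⟶ W)
    (hφ : ∀ s t : Δ, ((act s).hom ⊗ₘ (act t).hom) ≫ φ = φ) :
    ∃ ψ : Y ⊗ Y ⟶ W, (p ⊗ₘ p) ≫ ψ = φ := by
  haveI : IsProper X.hom := hX.isProper
  haveI : IsLocallyNoetherian X.left := LocallyOfFiniteType.isLocallyNoetherian X.hom
  haveI : IsLocallyNoetherian Y.left := LocallyOfFiniteType.isLocallyNoetherian Y.hom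
  have h1 : (act 1).hom = 𝟙 X := by rw [map_one]; rfl
  -- step 1: descend along `p ▷ X`
  have hφ₁ : ∀ g : Δ, ((act g).hom ▷ X) ≫ φ = φ := fun g => by
    rw [← tensorHom_id, ← h1]; exact hφ g 1
  obtain ⟨ψ₁, hψ₁⟩ := exists_desc_whiskerRight_of_isSepQuotient hX hY act p hq X hW φ hφ₁
  -- `ψ₁` is invariant under `Y ◁ act t`
  haveI : Surjective p.left := surjective_left_of_isSepQuotient hX hY act p hq
  haveI : Flat (p ▷ X).left := whiskerRight_left_mem' @Flat p ‹_›
  haveI : Surjective (p ▷ X).left := whiskerRight_left_mem' @Surjective p ‹_›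
  haveI : Epi (p ▷ X) := by
    haveI := Flat.epi_of_flat_of_surjective (p ▷ X).left
    exact Over.epi_of_epi_left _
  have hψ₁' : ∀ t : Δ, (Y ◁ (act t).hom) ≫ ψ₁ = ψ₁ := fun t => by
    rw [← cancel_epi (p ▷ X), ← Category.assoc, ← whisker_exchange, Category.assoc, hψ₁, ← id_tensorHom, ← h1]
    exact hφ 1 t
  -- step 2: descend `(β_ X Y).hom ≫ ψ₁` along `p ▷ Y`
  have hφ₂ : ∀ g : Δ, ((act g).hom ▷ Y) ≫ ((β_ X Y).hom ≫ ψ₁) = (β_ X Y).hom ≫ ψ₁ := fun g => by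
    rw [← Category.assoc, BraidedCategory.braiding_naturality_left, Category.assoc, hψ₁' g]
  obtain ⟨ψ₂, hψ₂⟩ := exists_desc_whiskerRight_of_isSepQuotient hX hY act p hq Y hW _ hφ₂
  refine ⟨(β_ Y Y).hom ≫ ψ₂, ?_⟩
  rw [MonoidalCategory.tensorHom_def, Category.assoc, ← Category.assoc (Y ◁ p), BraidedCategory.braiding_naturality_right,
    Category.assoc, hψ₂, ← Category.assoc (β_ Y X).hom, SymmetricCategory.symmetry, Category.id_comp, hψ₁]

end Literature.AlgebraicGeometry.Motives

end
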